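import Mathlib
import Summits.Ventures.HodgeRepro.MuTableSigns

/-!
# Liu's `μ`-admissible `ε` exists for every CM type (Route C, clause R3)

Blind re-derivation cell `pub-hodge-repro`, Tier 3, seat `t3-p2` (prover-pub-hodge-repro-t3-p2-g0-0).  Target
tree path `lean/Summits/Ventures/HodgeRepro/T3AdmissibleSign.lean`.  Imports: Mathlib + p2's `MuTableSigns`
(free signs in a CM field, weak approximation in `L⁺`).

Liu 2021 (arXiv:2102.11518), Definition 4.12, store p0020:L44–50: «In an adèlic oscillator triple `(μ, ε, ν)`, we
say that `ε` is `μ`-admissible if there exists some `e ∈ E^{−,×}` such that `ε_v = e·N_{E_v/F_v} E_v^×` for every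
nonarchimedean place `v` of `F`, and `τ′(e)` has negative imaginary part for every `τ′ ∈ Φ_μ`.»  Corollary 4.20
(p0023:L45–56) makes `A_μ` an isogeny factor of the Albanese `A_K` with multiplicity
`d(μ,K) = Σ_ε Σ_ν dim ω(μ,ε,ν)^K` over the `μ`-ADMISSIBLE `ε`; so the route's clause R3 («every weight-one `μ`
contributes», ROUTE-C §2 R3, the seat's note `proofs/t3-p2/R3R4-INSTANTIATION.md` §2(iii)) needs at least one
`μ`-admissible `ε`, i.e. a purely imaginary `e ≠ 0` with `Im τ′(e) < 0` for every `τ′` in the CM type `Φ_μ`.  Liu does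
not print this existence; it is weak approximation in `F = E⁺`: `E^{−} = e₀·F` and the sign of `Im τ′(e₀ f)` is the
sign of `τ(f)·Im τ′(e₀)`.

* `exists_conj_neg_ne_zero` — a CM field has a non-zero purely imaginary element (`complexConj e = −e`);
* `exists_conj_neg_im_neg` — for every finite set `Φ` of complex embeddings containing no conjugate pair (a CM type, or
  any part of one) there is a purely imaginary `e ≠ 0` with `Im φ(e) < 0` for all `φ ∈ Φ`.

Nothing here says anything about the status of the Hodge conjecture for CM abelian varieties, which is NOT proved.
-/

set_option autoImplicit false

namespace HodgeRepro.T3.AdmissibleSign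

open NumberField NumberField.InfinitePlace
open scoped ComplexConjugate
open Summit.Ventures.HodgeRepro.MuTableSigns (exists_conj_fixed_with_signs)

variable {L : Type} [Field L] [NumberField L] [NumberField.IsCMField L]

/-- A CM field contains a non-zero element `e` with `complexConj e = −e` (take `x − conj x` for any `x ∉ L⁺`). -/
theorem exists_conj_neg_ne_zero : ∃ e : L, IsCMField.complexConj L e = -e ∧ e ≠ 0 := by
  obtain ⟨x, hx⟩ : ∃ x : L, IsCMField.complexConj L x ≠ x := by
    by_contra h
    exact IsCMField.complexConj_ne_one L
      (AlgEquiv.ext fun x => (not_not.1 (not_exists.1 h x)).trans (AlgEquiv.one_apply x).symm)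
  refine ⟨x - IsCMField.complexConj L x, ?_, sub_ne_zero.2 hx.symm⟩
  rw [map_sub, IsCMField.complexConj_apply_apply, neg_sub]

/-- Under every complex embedding a purely imaginary element has real part `0`. -/
theorem re_map_eq_zero {e : L} (he : IsCMField.complexConj L e = -e) (φ : L →+* ℂ) : (φ e).re = 0 := by
  have h := IsCMField.complexEmbedding_complexConj L φ e
  rw [he, map_neg] at h
  have := congrArg Complex.re h
  simp only [Complex.neg_re, Complex.conj_re] at this
  linarith

/-- Under every complex embedding an element of `L⁺` has imaginary part `0`. -/
theorem im_map_eq_zero {a : L} (ha : IsCMField.complexConj L a = a) (φ : L →+* ℂ) : (φ a).im = 0 := by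
  have h := IsCMField.complexEmbedding_complexConj L φ a
  rw [ha] at h
  exact Complex.conj_eq_iff_im.1 h.symm

omit [NumberField L] [NumberField.IsCMField L] in
/-- The real part of `φ a` is that of the representative embedding of the place of `φ`. -/
theorem re_embedding_mk (φ : L →+* ℂ) (a : L) : ((InfinitePlace.mk φ).embedding a).re = (φ a).re := by
  rcases InfinitePlace.embedding_mk_eq φ with h | h
  · rw [h]
  · rw [h, ComplexEmbedding.conjugate_coe_eq, Complex.conj_re]

/-- **Liu Def 4.12, the existence half.**  For every finite set `Φ` of complex embeddings of the CM field `L`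
containing no conjugate pair there is a non-zero purely imaginary `e ∈ L` (`complexConj e = −e`, i.e. `e ∈ L^{−}`)
with `Im φ(e) < 0` for every `φ ∈ Φ`.  Proof: `e := a·e₀` with `e₀` purely imaginary non-zero and `a ∈ L⁺` of the
signs `sign φ(a) = −sign Im φ(e₀)` at the places of `Φ` (`exists_conj_fixed_with_signs`, weak approximation in `L⁺`);
`Im φ(a e₀) = φ(a)·Im φ(e₀)` since `φ(a)` is real. -/
theorem exists_conj_neg_im_neg (Φ : Finset (L →+* ℂ))
    (hΦ : ∀ φ ∈ Φ, ComplexEmbedding.conjugate φ ∉ Φ) :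
    ∃ e : L, IsCMField.complexConj L e = -e ∧ e ≠ 0 ∧ ∀ φ ∈ Φ, (φ e).im < 0 := by
  classical
  obtain ⟨e₀, he₀, hne⟩ := exists_conj_neg_ne_zero (L := L)
  have hre : ∀ φ : L →+* ℂ, (φ e₀).re = 0 := fun φ => re_map_eq_zero he₀ φ
  have him : ∀ φ : L →+* ℂ, (φ e₀).im ≠ 0 := by
    intro φ h0
    apply hne
    apply φ.injective
    rw [map_zero]
    exact Complex.ext (hre φ) h0
  obtain ⟨a, ha, ha0, hs⟩ := exists_conj_fixed_with_signs (L := L)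
    (fun w => decide (∃ φ ∈ Φ, InfinitePlace.mk φ = w ∧ (φ e₀).im < 0))
  refine ⟨a * e₀, ?_, mul_ne_zero ha0 hne, ?_⟩
  · rw [map_mul, ha, he₀, mul_neg]
  · intro φ hφ
    have haim : (φ a).im = 0 := im_map_eq_zero ha φ
    have hare : (φ a).re ≠ 0 := by
      intro h0
      apply ha0
      apply φ.injective
      rw [map_zero]
      exact Complex.ext h0 haim
    have hprod : (φ (a * e₀)).im = (φ a).re * (φ e₀).im := by
      rw [map_mul, Complex.mul_im, haim, hre φ]
      ring
    rw [hprod]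
    -- the sign of `φ a` at the place of `φ` is governed by `Im φ e₀`
    have hsign : 0 < (φ a).re ↔ (φ e₀).im < 0 := by
      rw [← re_embedding_mk φ a, hs (InfinitePlace.mk φ)]
      simp only [decide_eq_true_eq]
      constructor
      · rintro ⟨ψ, hψ, hψw, hψim⟩
        rcases InfinitePlace.mk_eq_iff.1 hψw with h | h
        · rwa [← h]
        · exact absurd (h ▸ hφ) (hΦ ψ hψ)
      · intro h
        exact ⟨φ, hφ, rfl, h⟩
    rcases lt_or_gt_of_ne (him φ) with h | h
    · exact mul_neg_of_pos_of_neg (hsign.2 h) h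
    · have hneg : (φ a).re < 0 :=
        lt_of_le_of_ne (not_lt.1 fun h' => absurd (hsign.1 h') (not_lt.2 h.le)) hare
      exact mul_neg_of_neg_of_pos hneg h

end HodgeRepro.T3.AdmissibleSign
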